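import Summits.QuantumFields.YangMills.Theorems.BalabanUVNodesC44IterMhPolydisc
import Summits.QuantumFields.YangMills.Theorems.BalabanUVNodesC44IterMhCauchyLine
import Literature.MathematicalPhysics.QuantumFieldTheory.Balaban1983to89.Node00.BgSchemeOfRecordProp4
import HarnessLib

/-!
# (ℓa-C) ROAD B, FILE F5 — THE RECORD INSTANCE: [B11] (44)∕Prop. 4's letter `Prop4LetterCAtRecord` (quadratic bound + analyticity of `C^{𝔰𝔩}` on a k-FREE ball) in the
# SMALL-FIELD APPROXIMATION (top-level profile `Ω_k = T`), from F4′'s polydisc stability and F4′-0's Cauchy line estimate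

Cell `pub-ymgap` ∕ `ym-nodeO-ideate`, porter lineage `ymgap-nodeO-port-PTB-1` (gen 7), hand «(44) for `iterMh`» (director-ym g22 №569/№571; PORT-PLAN-v5 dc7ff9950b0ac185, § F5).
`--kind proof --supports stmt-QuantumFields-27238 --as helper`; count-neutral.  [B7] = [Balaban1985Averaging]; [B11] = [Balaban1985Variational]; [I] = [Balaban1987RG1].

THE LETTER (node00-def-Y ✓`BgSchemeOfRecordProp4` :179): `Prop4LetterCAtRecord F N K k Ω U₀ levB C₂ c₄ := Prop4Hyp (CslOfRecord F N K k Ω U₀ levB) C₂ c₄` — for every `A′` of the space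
(115) with `‖A′‖ < c₄`: `‖C^{𝔰𝔩}(A′)‖ ≤ C₂‖A′‖²`, and `C^{𝔰𝔩}` ℂ-differentiable on that ball; `C^{𝔰𝔩}(A′) = (1/i)log(Ū^k_h(e^{iη_k·PA′}U₀)·Ū^k(U₀)⋆) − Q_k(U₀)(PA′)`, `P` the
traceless projection.  HERE: with `c₄ = (2·10¹¹·L·N)⁻¹`, `C₂ = 1.28·10¹⁶·L·N` (k-FREE; depending on `L, N` and `d = 4` only — admissible witnesses for print's «`C₂` depends on
`d, L`» up to the `SU(N)` guard `N‖W − 1‖ < π` of the printed `exp[mean log]`), UNDER: the (0.4) guard of `U₀` below `k`; a LOOP PROFILE `ε` of the real tower `Ū^j(U₀)`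
(`‖Ū^j(U₀)(loop) − 1‖ ≤ ε_j`, `ε_j ≤ 1∕50`, `N·ε_j ≤ 2`, `3·10⁵·Σ_{j<k}ε_j ≤ 1∕4` — [B9] (3.129)∕[B11] (14) at all scales, summable from the top); and the TOP-LEVEL PROFILE
`∀ x, x ∈ Ω_k` (PORT-PLAN-v5 (F-β): with a genuine large-field profile the letter as typed is false k-uniformly — `COfRecord` is `C_k` everywhere with output weight `1`).

PROOF.  For `‖A′‖ < c₄`, `X := η_k·ev(PA′)` is traceless with `L^k‖X‖_∞ ≤ 2‖A′‖` (top-level weights `L^kη_k = 1`, `‖π‖ ≤ 2`).  F4′-5 gives, for every traceless `Y` with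
`L^k‖Y‖ < ρ₀ = (2.5·10¹⁰·L·N)⁻¹`, the polydisc letter (loops within `1∕2`) and `‖Ū^k_h(e^{iY}U₀)Ū^k(U₀)⋆ − 1‖ ≤ 8000·L^k‖Y‖`; hence `G` is analytic at `Y` (✓`analyticAt_iterMh_of_polydisc`,
✓`analyticAt_logOver_apply`) with `‖G Y‖ ≤ 16000·L^k‖Y‖` ((26)), and F4′-0 ✓`norm_logChart_iterMh_sub_qCplxOp_le_of_linearBound` yields `‖G X − L^k·Q_kX‖ ≤ (8·16000∕ρ₀)(L^k‖X‖)²`;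
the components of `C^{𝔰𝔩}(A′)` ARE those of `G X − L^k·Q_kX` (`L^kη_k = 1`, F1 ✓`L_pow_mul_eta_cast`).  Analyticity: 3e′ ✓`analyticAt_COfRecord` at `PA′` with the same two letters.

WHAT IS PROVED (0 def, 0 sorry, axioms standard; ns `Summit.QuantumFields.YangMills.Theorems.C44IterMh`).
* `analyticAt_logChart_iterMh` (generic), `norm_logOver_le_two_mul` (generic: `‖G Y‖ ≤ 2·max_c‖Ū^k_h(c)Ū^k(c)⋆ − 1‖`), `L_pow_mul_eta_real`, `levWeight_bondLevLit_eq_one` (top level),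
  `norm_scaled_evLit_slProjLit_le` (`L^k‖η_k·ev(PA′)‖ ≤ 2‖A′‖`), `equiv_CslOfRecord_eq` (components of `C^{𝔰𝔩}` = components of `G X − L^k·Q_kX`).
* ★★★ `prop4LetterCAtRecord_of_loopProfile` — THE (ℓa-C) LETTER at `(C₂, c₄) = (1.28·10¹⁶·L·N, (2·10¹¹·L·N)⁻¹)`.

HONEST FRAMING.  (ℓa-C) is DISCHARGED here ONLY in the small-field approximation (`Ω_k = T`) and under a displayed, summable loop profile of the background tower; the constants are
crude; (ℓa-H)(ℓd) remain DISPLAYED; (R1)∕(R2) OPEN; K0ᴬ ⟨stmt-QuantumFields-27238⟩ NOT closed; K0ᴬ∕K1ᴬ∕K3ᴬ 0∕3; NODE O 0∕1; COUNT 8∕28 · K 1∕4 UNMOVED; finite `𝕋⁴_{L^K}` at fixed ε —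
NOT continuum ∕ ℝ⁴ ∕ OS; **the Yang–Mills mass gap (Clay) is NOT proved by any of this.**  No `sorry`, `instance`, `notation`, `set_option`; standard axioms.
-/

noncomputable section

open scoped Matrix Matrix.Norms.L2Operator InnerProductSpace ComplexConjugate Topology

namespace Summit.QuantumFields.YangMills.Theorems.C44IterMh

open Literature.MathematicalPhysics.QuantumFieldTheory.Balaban1983to89
open Literature.MathematicalPhysics.QuantumFieldTheory.Balaban1983to89.Node00
open T4Continuum BlockAveraging
open B15AveragingHolomorphic (loopMh iterMh coeField_iter_eq_iterMh)
open B15AveragingAnalytic (analyticAt_iterMh_of_polydisc)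
open B11Prop6Scheme (Prop4Hyp)
open B11Eq115Space (NegSup NegSize levWeight JetSup levWeight_apply le_levOf levOf_le)
open B12Lemma4Models (slProj slProj_apply)
open B11Eq103H1Complex (SiteL2K)
open MatrixLog (mlog norm_mlog_le_two_mul)
open ExpMeanLog (expMeanLogSU)

/-! ## §1  Generic: analyticity of the log-averaged chart from the two letters; the sup bound -/

section Generic

variable {P : Params} {N : ℕ} [NeZero N]

/-- **THE CHART IS ANALYTIC AT EVERY POINT CARRYING THE TWO LETTERS** (polydisc below `k`, log-disc at `k`) — Sect. G's composition: `exp`, the holomorphic averaging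
(✓`analyticAt_iterMh_of_polydisc`), `log` (✓`analyticAt_logOver_apply`). [cite: Balaban1985Variational, Sect. G p.307, Prop. 9 p.309; Balaban1987RG1, (0.4) p.253] -/
theorem analyticAt_logChart_iterMh (U₀ : GaugeField P 0 (SU N)) (k : ℕ) {X : PBond P 0 → Matrix (Fin N) (Fin N) ℂ}
    (hpoly : ∀ j, j < k → ∀ (c : PBond P (j + 1)) (i : Idx P), ‖loopMh (iterMh j (expOver U₀ X)) c i - 1‖ < 1)
    (hlog : ∀ c : PBond P k, ‖iterMh k (expOver U₀ X) c * star ((Averaging.iter (fun j => blockAvg (P := P) (j := j) expMeanLogSU) k U₀ c : SU N) : Matrix (Fin N) (Fin N) ℂ) - 1‖ < 1) :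
    AnalyticAt ℂ (fun Y : PBond P 0 → Matrix (Fin N) (Fin N) ℂ =>
      logOver (coeField (Averaging.iter (fun j => blockAvg (P := P) (j := j) expMeanLogSU) k U₀)) (iterMh k (expOver U₀ Y))) X := by
  have hiter : AnalyticAt ℂ (fun Y : PBond P 0 → Matrix (Fin N) (Fin N) ℂ => iterMh k (expOver U₀ Y)) X :=
    (analyticAt_iterMh_of_polydisc k hpoly).comp (analyticAt_expOver U₀ X)
  refine analyticAt_pi_iff.2 fun c => ?_
  exact (analyticAt_logOver_apply (coeField (Averaging.iter (fun j => blockAvg (P := P) (j := j) expMeanLogSU) k U₀)) c (hlog c)).comp_of_eq hiter rfl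

/-- `‖G Y‖ ≤ 2B` when every `‖Ū^k_h(e^{iY}U₀)(c)·Ū^k(U₀)(c)⋆ − 1‖ ≤ B ≤ 1∕2` ((26) `‖log W‖ ≤ 2‖W − 1‖`, `|1∕i| = 1`). [cite: Balaban1985Averaging, (26) p.22; Balaban1985Variational, (20) p.281] -/
theorem norm_logOver_le_two_mul (U₀ : GaugeField P 0 (SU N)) (k : ℕ) {Y : PBond P 0 → Matrix (Fin N) (Fin N) ℂ} {B : ℝ} (hB0 : 0 ≤ B) (hB : B ≤ 1 / 2)
    (h : ∀ c : PBond P k, ‖iterMh k (expOver U₀ Y) c * star ((Averaging.iter (fun j => blockAvg (P := P) (j := j) expMeanLogSU) k U₀ c : SU N) : Matrix (Fin N) (Fin N) ℂ) - 1‖ ≤ B) :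
    ‖logOver (coeField (Averaging.iter (fun j => blockAvg (P := P) (j := j) expMeanLogSU) k U₀)) (iterMh k (expOver U₀ Y))‖ ≤ 2 * B := by
  refine (pi_norm_le_iff_of_nonneg (by positivity)).2 fun c => ?_
  rw [logOver_apply, norm_smul, norm_inv, Complex.norm_I, inv_one, one_mul, coeField_apply]
  exact (norm_mlog_le_two_mul ((h c).trans hB)).trans (by linarith [h c])

end Generic

/-! ## §2  At the record: scalings, top-level weights, the components of `C^{𝔰𝔩}` -/

section Record

variable (F : T4Family) (N : ℕ) [NeZero N] {K : ℕ} (k : ℕ) (Ω : ℕ → Set (Site (F.P K) 0)) (U₀ : GaugeField (F.P K) 0 (SU N))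

omit [NeZero N] in
/-- `L^k · η_k = 1` (reals). [cite: Balaban1987RG1, (1.2) p.260] -/
theorem L_pow_mul_eta_real : (F.L : ℝ) ^ k * (F.P K).eta k = 1 := by
  have hL : (F.L : ℝ) ≠ 0 := Nat.cast_ne_zero.2 (by have := F.hL.2; omega)
  rw [Params.eta, T4Family.P_L, ← mul_pow, mul_inv_cancel₀ hL, one_pow]

omit [NeZero N] in
/-- **TOP-LEVEL WEIGHTS ARE `1`**: if every site lies in `Ω_k` then `j(b) = k` and `(L^{j(b)}η_k)¹ = 1`. [cite: Balaban1985Variational, p.286 («sup_j L^jη sup_{Ω_j}»)] -/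
theorem levWeight_bondLevLit_eq_one [Fact (0 < (F.L : ℝ))] [Fact (0 < (F.P K).eta k)] (hΩ : ∀ x, x ∈ Ω k) (b : B9SectCLatticeCarrier.Bond (F.P K).d (fun _ => (F.P K).sitesPerDir 0)) :
    levWeight (F.L : ℝ) ((F.P K).eta k) (bondLevLit F Ω k) 1 b = 1 := by
  have hlev : bondLevLit F Ω k b = k := le_antisymm (bondLevLit_le Ω k b) (le_levOf le_rfl (hΩ _))
  rw [levWeight_apply, hlev, pow_one, L_pow_mul_eta_real]

omit [NeZero N] in
/-- `‖π X‖ ≤ 2‖X‖` for the traceless projection `π X = X − N⁻¹(tr X)·1` (`|N⁻¹ tr X| ≤ ‖X‖`). [cite: Balaban1987RG1, (1.8) p.261 (bookkeeping)] -/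
theorem norm_slProj_le_two_mul [NeZero N] (X : Matrix (Fin N) (Fin N) ℂ) : ‖slProj N X‖ ≤ 2 * ‖X‖ := by
  haveI : Nonempty (Fin N) := ⟨⟨0, Nat.pos_of_ne_zero (NeZero.ne N)⟩⟩
  rw [slProj_apply]
  have h1 : ‖((N : ℂ)⁻¹ * X.trace) • (1 : Matrix (Fin N) (Fin N) ℂ)‖ ≤ ‖X‖ := by
    rw [norm_smul, norm_one, mul_one]
    have h := MatrixNorms.norm_ntr_le_opNorm X
    rw [MatrixNorms.ntr, Fintype.card_fin, div_eq_inv_mul] at h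
    exact h
  exact (norm_sub_le _ _).trans (by linarith)

/-- **`L^k·‖η_k·ev(PA′)‖_∞ ≤ 2‖A′‖`** under the top-level profile (weights `1`, `‖π‖ ≤ 2`). [cite: Balaban1985Variational, (19) p.281, (51) p.286, (115) p.294] -/
theorem norm_scaled_evLit_slProjLit_le [Fact (0 < (F.L : ℝ))] [Fact (0 < (F.P K).eta k)] (hΩ : ∀ x, x ∈ Ω k) (A : Space115Lit F N K k Ω U₀) :
    (F.L : ℝ) ^ k * ‖((((F.P K).eta k : ℝ) : ℂ)) • evLit F N K k Ω U₀ (slProjLit F N K k Ω U₀ A)‖ ≤ 2 * ‖A‖ := by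
  have hη0 : 0 < (F.P K).eta k := Fact.out
  have hLk : 0 < (F.L : ℝ) ^ k := pow_pos Fact.out k
  rw [norm_smul, Complex.norm_real, Real.norm_of_nonneg hη0.le, ← mul_assoc, L_pow_mul_eta_real, one_mul]
  refine (pi_norm_le_iff_of_nonneg (by positivity)).2 fun b => ?_
  rw [evLit_slProjLit, evLit_apply]
  refine (norm_slProj_le_two_mul N _).trans ?_
  have h := JetSup.weight_mul_norm_apply_le A (bondToLit (F.P K) 0 b)
  rw [levWeight_bondLevLit_eq_one F k Ω hΩ, one_mul] at h
  linarith

/-- **THE COMPONENTS OF `C^{𝔰𝔩}(A′)` ARE THOSE OF `G X − L^k·Q_k(U₀)X`**, `X = η_k·ev(PA′)` (`L^kη_k = 1`). [cite: Balaban1985Variational, (44) p.285, (20) p.281; Balaban1985BackgroundPropagators, (3.13) p.393] -/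
theorem equiv_CslOfRecord_eq [Fact (0 < (F.L : ℝ))] [Fact (0 < (F.P K).eta k)] (levB : PBond (F.P K) k → ℕ) (A : Space115Lit F N K k Ω U₀) (c : PBond (F.P K) k) :
    NegSup.equiv _ _ (CslOfRecord F N K k Ω U₀ levB A) c =
      (logOver (coeField (Averaging.iter (fun j => blockAvg (P := F.P K) (j := j) expMeanLogSU) k U₀))
          (iterMh k (expOver U₀ ((((F.P K).eta k : ℝ) : ℂ) • evLit F N K k Ω U₀ (slProjLit F N K k Ω U₀ A))))
        - ((F.P K).L : ℂ) ^ k • qCplxOp k U₀ ((((F.P K).eta k : ℝ) : ℂ) • evLit F N K k Ω U₀ (slProjLit F N K k Ω U₀ A))) c := by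
  rw [CslOfRecord_apply, COfRecord_apply, Pi.sub_apply, logOver_apply, coeField_apply, Pi.smul_apply, map_smul, Pi.smul_apply, smul_smul, L_pow_mul_eta_cast F k, one_smul]
  rfl

/-! ## §3  The (ℓa-C) letter at the record -/

/-- ★★★ **[B11] (44) ∕ PROP. 4's (ℓa-C) LETTER AT THE RECORD, SMALL-FIELD APPROXIMATION**: under the (0.4) guard of `U₀` below `k`, a summable loop profile `ε` of the real tower
(`ε_j ≤ 1∕50`, `N·ε_j ≤ 2`, `3·10⁵·Σ_{j<k}ε_j ≤ 1∕4`) and the top-level profile `∀ x, x ∈ Ω_k`: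
`Prop4LetterCAtRecord F N K k Ω U₀ levB (1.28·10¹⁶·L·N) ((2·10¹¹·L·N)⁻¹)` — `‖C^{𝔰𝔩}(A′)‖ ≤ C₂‖A′‖²` and ℂ-differentiability on `‖A′‖ < c₄`, with `(C₂, c₄)` k-FREE («The constants
… depend on d and L only», here also on `N` through the printed average's `SU(N)` guard). [cite: Balaban1985Variational, (44) p.285, Prop. 4 (97)–(98) pp.292–293, (51)–(53) p.286; Balaban1987RG1, (0.8) p.253; Balaban1985Averaging, Proposition 3 p.36, Proposition 7 p.43] -/
theorem prop4LetterCAtRecord_of_loopProfile [Fact (0 < (F.L : ℝ))] [Fact (0 < (F.P K).eta k)] [Fact (0 < c0Rec F K k)] [Fact (∀ c, 0 < wBRec F K k c)]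
    (levB : PBond (F.P K) k → ℕ) (hU₀ : SmallBelow (avOfRecord F N K) k U₀) (hΩ : ∀ x, x ∈ Ω k)
    (εs : ℕ → ℝ) (hε0 : ∀ j, 0 ≤ εs j)
    (hε : ∀ j, j < k → ∀ (c : PBond (F.P K) (j + 1)) (i : Idx (F.P K)), ‖loopM (coeField (Averaging.iter (avOfRecord F N K) j U₀)) c i - 1‖ ≤ εs j)
    (hε50 : ∀ j, j < k → εs j ≤ 1 / 50) (hNε : ∀ j, j < k → (N : ℝ) * εs j ≤ 2) (hεsum : 300000 * (Finset.range k).sum εs ≤ 1 / 4) :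
    Prop4LetterCAtRecord F N K k Ω U₀ levB (12800000000000000 * (F.L : ℝ) * N) (1 / (200000000000 * (F.L : ℝ) * N)) := by
  -- constants and casts
  have hN1 : (1 : ℝ) ≤ N := by exact_mod_cast Nat.one_le_iff_ne_zero.2 (NeZero.ne N)
  have hL12 : (12 : ℝ) ≤ F.L := by exact_mod_cast F.hL11
  have hd4 : ((F.P K).d : ℝ) = 4 := by rw [T4Family.P_d]; norm_num
  have hPL : ((F.P K).L : ℝ) = F.L := by rw [T4Family.P_L]
  have hLN : 0 < (F.L : ℝ) * N := by positivity
  set ρ₀ : ℝ := 1 / (25000000000 * (F.L : ℝ) * N) with hρ₀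
  have hρ₀pos : 0 < ρ₀ := by positivity
  have hρ₀LN : ρ₀ * ((F.L : ℝ) * N) = 1 / 25000000000 := by rw [hρ₀]; field_simp
  have hLN1 : (1 : ℝ) ≤ (F.L : ℝ) * N := by nlinarith
  have hρ₀le : ρ₀ ≤ 1 / 25000000000 := by
    rw [hρ₀]
    exact one_div_le_one_div_of_le (by norm_num) (by linarith [mul_le_mul_of_nonneg_left hLN1 (by norm_num : (0:ℝ) ≤ 25000000000)])
  have hc₄' : 1 / (200000000000 * (F.L : ℝ) * N) = ρ₀ / 8 := by
    rw [hρ₀, div_div]; congr 1; ring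
  -- the F4′ package for every traceless `Y` with `L^k‖Y‖ < ρ₀`
  have hpack : ∀ Y : PBond (F.P K) 0 → Matrix (Fin N) (Fin N) ℂ, (∀ b, (Y b).trace = 0) → (F.L : ℝ) ^ k * ‖Y‖ < ρ₀ →
      (∀ j, j < k → ∀ (c : PBond (F.P K) (j + 1)) (i : Idx (F.P K)), ‖loopMh (iterMh j (expOver U₀ Y)) c i - 1‖ ≤ 1 / 2) ∧
      (∀ c : PBond (F.P K) k, ‖iterMh k (expOver U₀ Y) c * star ((Averaging.iter (fun j => blockAvg (P := F.P K) (j := j) expMeanLogSU) k U₀ c : SU N) : Matrix (Fin N) (Fin N) ℂ) - 1‖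
        ≤ 8000 * ((F.L : ℝ) ^ k * ‖Y‖)) := by
    intro Y hY hsmall
    have hY0 : 0 ≤ (F.L : ℝ) ^ k * ‖Y‖ := by positivity
    have hNρ : (N : ℝ) * ((F.L : ℝ) ^ k * ‖Y‖) ≤ 1 / 25000000000 := by
      have h1 : (N : ℝ) * ((F.L : ℝ) ^ k * ‖Y‖) ≤ N * ρ₀ := mul_le_mul_of_nonneg_left hsmall.le (by positivity)
      have h2 : (N : ℝ) * ρ₀ ≤ ρ₀ * ((F.L : ℝ) * N) := by nlinarith
      linarith
    have hρ' : 8 * (((F.P K).d : ℝ) + 1) * (((F.P K).L : ℝ) ^ k * (2 * ‖Y‖)) ≤ 1 / 10 ^ 6 := by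
      rw [hd4, hPL]; nlinarith
    have hQ' : 2 * (20000000 * (((F.P K).d : ℝ) + 1) ^ 2 * (F.P K).L) * (((F.P K).L : ℝ) ^ k * (2 * ‖Y‖)) + (60000 * (((F.P K).d : ℝ) + 1)) * (Finset.range k).sum εs ≤ 1 / 2 := by
      rw [hd4, hPL]
      have h1 : (F.L : ℝ) * ((F.L : ℝ) ^ k * ‖Y‖) ≤ F.L * ρ₀ := mul_le_mul_of_nonneg_left hsmall.le (by positivity)
      have h2 : (F.L : ℝ) * ρ₀ ≤ ρ₀ * ((F.L : ℝ) * N) := by nlinarith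
      nlinarith
    have hN' : ∀ j, j < k → (N : ℝ) * (56 * (((F.P K).d : ℝ) + 1) * (((F.P K).L : ℝ) ^ k * (2 * ‖Y‖)) + εs j) ≤ 3 := by
      intro j hj; rw [hd4, hPL]; nlinarith [hNε j hj]
    refine ⟨fun j hj c i => norm_loopMh_iterMh_expOver_sub_one_le U₀ k hU₀ εs hε0 hε hε50 hY hρ' hQ' hN' hj c i, fun c => ?_⟩
    have h := norm_iterMh_expOver_mul_star_sub_one_le U₀ k hU₀ εs hε0 hε hε50 hY hρ' hQ' hN' c
    rw [hd4, hPL] at h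
    linarith
  -- the chart is analytic with the linear bound on the traceless scaled polydisc
  have hdiff : ∀ Y : PBond (F.P K) 0 → Matrix (Fin N) (Fin N) ℂ, (∀ b, (Y b).trace = 0) → ((F.P K).L : ℝ) ^ k * ‖Y‖ < ρ₀ →
      DifferentiableAt ℂ (fun Y : PBond (F.P K) 0 → Matrix (Fin N) (Fin N) ℂ =>
        logOver (coeField (Averaging.iter (fun j => blockAvg (P := F.P K) (j := j) expMeanLogSU) k U₀)) (iterMh k (expOver U₀ Y))) Y := by
    intro Y hY hsmall
    rw [hPL] at hsmall
    obtain ⟨hp, hl⟩ := hpack Y hY hsmall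
    refine (analyticAt_logChart_iterMh U₀ k (fun j hj c i => lt_of_le_of_lt (hp j hj c i) (by norm_num)) fun c => lt_of_le_of_lt (hl c) ?_).differentiableAt
    nlinarith [hρ₀le]
  have hbound : ∀ Y : PBond (F.P K) 0 → Matrix (Fin N) (Fin N) ℂ, (∀ b, (Y b).trace = 0) → ((F.P K).L : ℝ) ^ k * ‖Y‖ < ρ₀ →
      ‖logOver (coeField (Averaging.iter (fun j => blockAvg (P := F.P K) (j := j) expMeanLogSU) k U₀)) (iterMh k (expOver U₀ Y))‖ ≤ 16000 * (((F.P K).L : ℝ) ^ k * ‖Y‖) := by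
    intro Y hY hsmall
    rw [hPL] at hsmall ⊢
    obtain ⟨-, hl⟩ := hpack Y hY hsmall
    have hY0 : 0 ≤ (F.L : ℝ) ^ k * ‖Y‖ := by positivity
    have h := norm_logOver_le_two_mul U₀ k (by positivity) (by nlinarith [hρ₀le]) hl
    linarith
  refine ⟨fun A hA => ?_, fun A hA => ?_⟩
  · -- the quadratic bound
    have hA0 := norm_nonneg A
    set X : PBond (F.P K) 0 → Matrix (Fin N) (Fin N) ℂ := ((((F.P K).eta k : ℝ) : ℂ)) • evLit F N K k Ω U₀ (slProjLit F N K k Ω U₀ A) with hX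
    have hXtr : ∀ b, (X b).trace = 0 := fun b => by
      rw [hX, Pi.smul_apply, Matrix.trace_smul, evLit_apply, trace_equiv_slProjLit (F := F) (N := N) (K := K) (k := k) (Ω := Ω) (U₀ := U₀) A _, smul_zero]
    have hXn : (F.L : ℝ) ^ k * ‖X‖ ≤ 2 * ‖A‖ := norm_scaled_evLit_slProjLit_le F N k Ω U₀ hΩ A
    have hc₄ : 2 * (1 / (200000000000 * (F.L : ℝ) * N)) ≤ ρ₀ / 4 := by rw [hc₄']; linarith
    have hXρ : 4 * (((F.P K).L : ℝ) ^ k * ‖X‖) ≤ ρ₀ := by rw [hPL]; linarith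
    have hmain := norm_logChart_iterMh_sub_qCplxOp_le_of_linearBound U₀ hU₀ (by norm_num : (0:ℝ) ≤ 16000) hdiff hbound hXtr hXρ
    rw [hPL] at hmain
    have hC : 8 * 16000 / ρ₀ * ((F.L : ℝ) ^ k * ‖X‖) ^ 2 ≤ 12800000000000000 * (F.L : ℝ) * N * ‖A‖ ^ 2 := by
      have h1 : ((F.L : ℝ) ^ k * ‖X‖) ^ 2 ≤ (2 * ‖A‖) ^ 2 := pow_le_pow_left₀ (by positivity) hXn 2
      have h2 : 8 * 16000 / ρ₀ = 512000 * (25000000000 * (F.L : ℝ) * N) / 4 := by rw [hρ₀]; field_simp; ring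
      rw [h2]
      nlinarith [mul_le_mul_of_nonneg_left h1 (by positivity : (0:ℝ) ≤ 512000 * (25000000000 * (F.L : ℝ) * N) / 4)]
    refine (NegSup.norm_le_iff (by positivity)).2 fun c => ?_
    rw [levWeight_apply, pow_zero, one_mul, equiv_CslOfRecord_eq F N k Ω U₀ levB A c]
    exact (norm_le_pi_norm _ c).trans (hmain.trans hC)
  · -- differentiability on the ball: `C^{𝔰𝔩} = C ∘ P` is analytic at `A′`
    have hXn : (F.L : ℝ) ^ k * ‖((((F.P K).eta k : ℝ) : ℂ)) • evLit F N K k Ω U₀ (slProjLit F N K k Ω U₀ A)‖ ≤ 2 * ‖A‖ := norm_scaled_evLit_slProjLit_le F N k Ω U₀ hΩ A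
    have hXtr : ∀ b, ((((((F.P K).eta k : ℝ) : ℂ)) • evLit F N K k Ω U₀ (slProjLit F N K k Ω U₀ A)) b).trace = 0 := fun b => by
      rw [Pi.smul_apply, Matrix.trace_smul, evLit_apply, trace_equiv_slProjLit (F := F) (N := N) (K := K) (k := k) (Ω := Ω) (U₀ := U₀) A _, smul_zero]
    have hsmall : (F.L : ℝ) ^ k * ‖((((F.P K).eta k : ℝ) : ℂ)) • evLit F N K k Ω U₀ (slProjLit F N K k Ω U₀ A)‖ < ρ₀ := by
      have hA' : ‖A‖ < 1 / (200000000000 * (F.L : ℝ) * N) := hA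
      have : 2 * (1 / (200000000000 * (F.L : ℝ) * N)) ≤ ρ₀ := by rw [hc₄']; linarith
      linarith
    obtain ⟨hp, hl⟩ := hpack _ hXtr hsmall
    have han : AnalyticAt ℂ (COfRecord F N K k Ω U₀ levB) (slProjLit F N K k Ω U₀ A) :=
      analyticAt_COfRecord F N k Ω U₀ levB _ (fun j hj c i => lt_of_le_of_lt (hp j hj c i) (by norm_num)) fun c => lt_of_le_of_lt (hl c) (by
        linarith [hsmall, hρ₀le])
    exact (han.comp ((slProjLit F N K k Ω U₀).analyticAt A)).differentiableAt.differentiableWithinAt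

end Record

/-! ## §4  Through the door: Prop. 4 at the record with (ℓa-C) discharged -/

section Door

variable (F : T4Family) (N : ℕ) [NeZero N] (K k : ℕ) (Ω : ℕ → Set (Site (F.P K) 0)) (U₀ : GaugeField (F.P K) 0 (SU N))

/-- ★ **PROP. 4 AT THE RECORD WITH THE (ℓa-C) SLOT FILLED** (small-field approximation, loop profile): node00-def-Y's door ✓`prop4UniformAtRecord_of_letters_of_norm_J_le` with
`hC := prop4LetterCAtRecord_of_loopProfile`; the remaining named letters — (ℓa-H) `b`, the numbers (ℓa-num) at `(C₂, c₄) = (1.28·10¹⁶·L·N, (2·10¹¹·L·N)⁻¹)`, (ℓb), (ℓc), (ℓd), `‖J‖ ≤ nJ` —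
stay HYPOTHESES (DISPLAYED, (R1)-class).  Glue; no new estimate. [cite: Balaban1985Variational, Prop. 4 (97)–(98) pp.292–293, (44) p.285] -/
theorem prop4UniformAtRecord_of_letters_loopProfile [Fact (0 < (F.L : ℝ))] [Fact (0 < (F.P K).eta k)] [Fact (0 < c0Rec F K k)] [Fact (∀ c, 0 < wBRec F K k c)]
    (levB : PBond (F.P K) k → ℕ) (a : ℝ)
    (hpos : ∀ x, x ≠ 0 → 0 < RCLike.re ⟪x, laplaceAOfRecord F N k U₀ (QOfRecord F N k U₀) (QflatOfRecord F N k) a x⟫_ℂ)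
    (hQ : Function.Surjective (QOfRecord F N k U₀)) {εC : ℝ}
    (Gp : SiteL2K ℂ (F.P K).d (fun _ => (F.P K).sitesPerDir 0) (c0Rec F K k) (WRec N) →ₗ[ℂ]
      SiteL2K ℂ (F.P K).d (fun _ => (F.P K).sitesPerDir 0) (c0Rec F K k) (WRec N))
    {b aC CV RV R' θ₃ θE θE' N₁ nJ : ℝ}
    (hU₀ : SmallBelow (avOfRecord F N K) k U₀) (hΩ : ∀ x, x ∈ Ω k) (εs : ℕ → ℝ) (hε0 : ∀ j, 0 ≤ εs j)
    (hε : ∀ j, j < k → ∀ (c : PBond (F.P K) (j + 1)) (i : Idx (F.P K)), ‖loopM (coeField (Averaging.iter (avOfRecord F N K) j U₀)) c i - 1‖ ≤ εs j)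
    (hε50 : ∀ j, j < k → εs j ≤ 1 / 50) (hNε : ∀ j, j < k → (N : ℝ) * εs j ≤ 2) (hεsum : 300000 * (Finset.range k).sum εs ≤ 1 / 4)
    (hH : Prop4LetterHAtRecord F N K k Ω U₀ levB a hpos hQ b)
    (hnum : Prop4LetterNum b (12800000000000000 * (F.L : ℝ) * N) (1 / (200000000000 * (F.L : ℝ) * N)) aC εC RV R')
    (hV : Prop4LetterV0AtRecord F N K k Ω U₀ CV RV) (hsym : Prop4LetterSymmAtRecord F N K k Ω U₀ Gp)
    (hcol : Prop4LetterColumnsAtRecord F N K k Ω U₀ levB a hpos hQ εC Gp R' θ₃ θE θE' N₁) (hJ : ‖JOfRecordAtBg F N K k Ω U₀‖ ≤ nJ) :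
    Prop4UniformAtRecord F N K k Ω U₀ levB a hpos hQ εC Gp (c4OfRecord N nJ b (12800000000000000 * (F.L : ℝ) * N) εC aC CV R' θ₃ θE θE' N₁) R' :=
  prop4UniformAtRecord_of_letters_of_norm_J_le F N K k Ω U₀ levB a hpos hQ Gp hH
    (prop4LetterCAtRecord_of_loopProfile F N k Ω U₀ levB hU₀ hΩ εs hε0 hε hε50 hNε hεsum) hnum hV hsym hcol hJ

end Door

end Summit.QuantumFields.YangMills.Theorems.C44IterMh

end
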